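import Mathlib

/-!
# Many cliques in a one-sidedly dense vertex set — item stmt-PneNP-9816
# `RamseyUncertifiable.ResolutionUncertainty` (support), counting input for the TREE-LIKE rung

`pow_le_factorial_mul_card_cliqueFinset`: if inside a vertex set `S` the graph `G` has edge density `≥ δ` between
every two DISJOINT subsets of size `≥ M` (`0 < δ ≤ 4`, `1 ≤ M`), then for every `T` with room
`4M ≤ (δ/4)^T · |S|` the graph has at least `(3M)^T / T!` cliques of size `T`.

Proof (greedy with few bad vertices). For `W ⊆ S` with `|W| ≥ 4M`, fewer than `M` vertices `w ∈ W` have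
`< (δ/4)|W|` neighbours in `W` (`card_sparse_lt`: otherwise `M` of them form a set `A` with `d(A, W ∖ A) ≥ δ`, and some
`a ∈ A` has `≥ δ|W ∖ A| ≥ (3δ/4)|W|` neighbours in `W`). Let `𝒦_t` be the `t`-cliques `Q ⊆ S` whose common
neighbourhood `W(Q)` in `S` has `|W(Q)| ≥ (δ/4)^t |S|`; each `Q ∈ 𝒦_t` (`t < T`) extends by any of `≥ 3M` good vertices
of `W(Q)` to a member of `𝒦_{t+1}`, and each member of `𝒦_{t+1}` arises from at most `t + 1` members of `𝒦_t`; double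
counting gives `3M·|𝒦_t| ≤ (t+1)·|𝒦_{t+1}|`, whence `(3M)^T ≤ T!·|𝒦_T|`. Used with the Prömel–Rödl core of a 2-Ramsey
graph (`M = ⌈|S|^{1-β}⌉`, `T = Θ(log |S|)`) to get `n^{Ω(log n)}` cliques. [folklore greedy counting; cf.
Lauria–Pudlák–Rödl–Thapen arXiv:1303.3166, Cor. 12]
-/

set_option linter.dupNamespace false

namespace Summit.PneNP.PneNP.Theorems.RamseyUncertifiableResolutionUncertainty

open Finset

section Counting

variable {n : ℕ} (G : SimpleGraph (Fin n)) [DecidableRel G.Adj]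

/-- Ordered edge count between `A` and `B` as the sum over `a ∈ A` of the degrees of `a` into `B`. -/
theorem card_interedges_eq_sum_degree (A B : Finset (Fin n)) :
    (G.interedges A B).card = ∑ a ∈ A, (B.filter fun b => G.Adj a b).card := by
  rw [SimpleGraph.interedges_def, Finset.card_filter, Finset.sum_product]
  refine Finset.sum_congr rfl fun a _ => ?_
  rw [Finset.card_filter]

/-- **Few sparse vertices.** If `G` has density `≥ δ > 0` between all disjoint pairs of `M`-subsets of `S` (`M ≥ 1`),
then in every `W ⊆ S` with `|W| ≥ 4M` fewer than `M` vertices have `< (δ/4)|W|` neighbours inside `W`. -/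
theorem card_sparse_lt (S W : Finset (Fin n)) (hWS : W ⊆ S) {M : ℕ} {δ : ℝ} (hδ : 0 < δ) (hM : 1 ≤ M)
    (hdense : ∀ A ⊆ S, ∀ B ⊆ S, Disjoint A B → M ≤ A.card → M ≤ B.card → δ ≤ (G.edgeDensity A B : ℝ))
    (hW : 4 * M ≤ W.card) :
    (W.filter fun w => (((W.filter fun b => G.Adj w b).card : ℝ) < δ / 4 * W.card)).card < M := by
  by_contra hge
  push Not at hge
  obtain ⟨A, hA, hAcard⟩ := Finset.exists_subset_card_eq hge
  have hAW : A ⊆ W := hA.trans (Finset.filter_subset _ _)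
  set B : Finset (Fin n) := W \ A with hB
  have hBW : B ⊆ W := Finset.sdiff_subset
  have hBcard : B.card = W.card - M := by rw [hB, Finset.card_sdiff_of_subset hAW, hAcard]
  have hMB : M ≤ B.card := by rw [hBcard]; omega
  have hdisj : Disjoint A B := Finset.disjoint_sdiff
  have hd := hdense A (hAW.trans hWS) B (hBW.trans hWS) hdisj hAcard.ge hMB
  -- unpack the density
  have hApos : (0 : ℝ) < A.card := by rw [hAcard]; exact_mod_cast hM
  have hBpos : (0 : ℝ) < B.card := by exact_mod_cast lt_of_lt_of_le (by omega : 0 < M) hMB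
  have hdens : δ * (A.card * B.card) ≤ ((G.interedges A B).card : ℝ) := by
    have : (G.edgeDensity A B : ℝ) = ((G.interedges A B).card : ℝ) / (A.card * B.card) := by
      rw [SimpleGraph.edgeDensity_def]; push_cast; ring
    rw [this, le_div_iff₀ (mul_pos hApos hBpos)] at hd
    exact hd
  rw [card_interedges_eq_sum_degree] at hdens
  push_cast at hdens
  -- some `a ∈ A` has many neighbours in `B`
  have hAne : A.Nonempty := by rw [← Finset.card_pos, hAcard]; omega
  obtain ⟨a, haA, ha⟩ : ∃ a ∈ A, δ * B.card ≤ ((B.filter fun b => G.Adj a b).card : ℝ) := by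
    apply Finset.exists_le_of_sum_le hAne
    rw [Finset.sum_const, nsmul_eq_mul]
    linarith
  -- but `a` is sparse into `W ⊇ B`
  have hsparse := (Finset.mem_filter.1 (hA haA)).2
  have hmono : ((B.filter fun b => G.Adj a b).card : ℝ) ≤ ((W.filter fun b => G.Adj a b).card : ℝ) := by
    exact_mod_cast Finset.card_le_card (Finset.filter_subset_filter _ hBW)
  have hWcard : (4 * M : ℝ) ≤ W.card := by exact_mod_cast hW
  have hBW' : (B.card : ℝ) = W.card - M := by
    rw [hBcard, Nat.cast_sub (le_trans (by omega) hW)]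
  have hMr : (1 : ℝ) ≤ M := by exact_mod_cast hM
  nlinarith

/-- **The greedy extension step (double counting).** Write `W(Q)` for the common neighbourhood of `Q` inside `S` and
`𝒦_t` for the `t`-cliques `Q ⊆ S` with `|W(Q)| ≥ (δ/4)^t|S|`. If `4M ≤ (δ/4)^t|S|` then `3M·|𝒦_t| ≤ (t+1)·|𝒦_{t+1}|`. -/
theorem three_mul_card_cliques_le (S : Finset (Fin n)) {M : ℕ} {δ : ℝ} (hδ : 0 < δ) (hM : 1 ≤ M)
    (hdense : ∀ A ⊆ S, ∀ B ⊆ S, Disjoint A B → M ≤ A.card → M ≤ B.card → δ ≤ (G.edgeDensity A B : ℝ))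
    (t : ℕ) (hroom : (4 * M : ℝ) ≤ (δ / 4) ^ t * S.card) :
    3 * M * ((G.cliqueFinset t).filter fun Q => Q ⊆ S ∧
        (δ / 4) ^ t * S.card ≤ ((S.filter fun v => ∀ q ∈ Q, G.Adj q v).card : ℝ)).card ≤
      (t + 1) * ((G.cliqueFinset (t + 1)).filter fun Q => Q ⊆ S ∧
        (δ / 4) ^ (t + 1) * S.card ≤ ((S.filter fun v => ∀ q ∈ Q, G.Adj q v).card : ℝ)).card := by
  classical
  set Kt := (G.cliqueFinset t).filter fun Q => Q ⊆ S ∧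
      (δ / 4) ^ t * S.card ≤ ((S.filter fun v => ∀ q ∈ Q, G.Adj q v).card : ℝ) with hKt
  set Kt1 := (G.cliqueFinset (t + 1)).filter fun Q => Q ⊆ S ∧
      (δ / 4) ^ (t + 1) * S.card ≤ ((S.filter fun v => ∀ q ∈ Q, G.Adj q v).card : ℝ) with hKt1
  rw [mul_comm (3 * M), mul_comm (t + 1)]
  refine Finset.card_mul_le_card_mul (r := fun Q Q' => Q ⊆ Q') (fun Q hQ => ?_) (fun Q' hQ' => ?_)
  · -- at least `3M` extensions of `Q` inside `Kt1`
    obtain ⟨hQcl, hQS, hQW⟩ := Finset.mem_filter.1 hQ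
    have hQcl' : G.IsNClique t Q := SimpleGraph.mem_cliqueFinset_iff.1 hQcl
    set W := S.filter fun v => ∀ q ∈ Q, G.Adj q v with hW
    have hWS : W ⊆ S := Finset.filter_subset _ _
    have hW4 : 4 * M ≤ W.card := by exact_mod_cast hroom.trans hQW
    set Bad := W.filter fun w => (((W.filter fun b => G.Adj w b).card : ℝ) < δ / 4 * W.card) with hBad
    have hBadlt : Bad.card < M := card_sparse_lt G S W hWS hδ hM hdense hW4
    set Good := W \ Bad with hGood
    have hGoodcard : 3 * M ≤ Good.card := by
      have : Good.card = W.card - Bad.card := Finset.card_sdiff_of_subset (Finset.filter_subset _ _)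
      omega
    -- `w ↦ insert w Q` maps `Good` injectively into the extensions of `Q`
    have hnotin : ∀ w ∈ W, w ∉ Q := by
      intro w hw hwQ
      have := (Finset.mem_filter.1 hw).2 w hwQ
      exact G.irrefl this
    calc 3 * M ≤ Good.card := hGoodcard
      _ ≤ (Kt1.bipartiteAbove (fun Q Q' => Q ⊆ Q') Q).card := by
        refine Finset.card_le_card_of_injOn (fun w => insert w Q) (fun w hw => ?_) ?_
        · have hwW : w ∈ W := Finset.sdiff_subset hw
          have hwgood : ¬ (((W.filter fun b => G.Adj w b).card : ℝ) < δ / 4 * W.card) := fun h =>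
            (Finset.mem_sdiff.1 hw).2 (Finset.mem_filter.2 ⟨hwW, h⟩)
          have hwadj : ∀ q ∈ Q, G.Adj q w := (Finset.mem_filter.1 hwW).2
          rw [Finset.mem_coe, Finset.mem_bipartiteAbove]
          refine ⟨Finset.mem_filter.2 ⟨?_, ?_, ?_⟩, Finset.subset_insert _ _⟩
          · exact SimpleGraph.mem_cliqueFinset_iff.2 (hQcl'.insert fun q hq => (hwadj q hq).symm)
          · exact Finset.insert_subset (hWS hwW) hQS
          · -- the new common neighbourhood is `W ∩ N(w)`, of size `≥ (δ/4)|W|`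
            have hsub : (W.filter fun b => G.Adj w b) ⊆ S.filter fun v => ∀ q ∈ insert w Q, G.Adj q v := by
              intro v hv
              obtain ⟨hvW, hvw⟩ := Finset.mem_filter.1 hv
              obtain ⟨hvS, hvQ⟩ := Finset.mem_filter.1 hvW
              refine Finset.mem_filter.2 ⟨hvS, fun q hq => ?_⟩
              rcases Finset.mem_insert.1 hq with rfl | hq
              · exact hvw
              · exact hvQ q hq
            have h1 : ((W.filter fun b => G.Adj w b).card : ℝ) ≤
                ((S.filter fun v => ∀ q ∈ insert w Q, G.Adj q v).card : ℝ) := by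
              exact_mod_cast Finset.card_le_card hsub
            push Not at hwgood
            have hδ4 : (0 : ℝ) ≤ δ / 4 := by positivity
            calc (δ / 4) ^ (t + 1) * S.card = δ / 4 * ((δ / 4) ^ t * S.card) := by ring
              _ ≤ δ / 4 * W.card := mul_le_mul_of_nonneg_left hQW hδ4
              _ ≤ _ := hwgood.trans h1
        · intro w hw w' hw' h
          have h : insert w Q = insert w' Q := h
          have hwQ : w ∉ Q := hnotin w (Finset.sdiff_subset hw)
          have : w ∈ insert w' Q := by rw [← h]; exact Finset.mem_insert_self _ _
          rcases Finset.mem_insert.1 this with h' | h'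
          · exact h'
          · exact absurd h' hwQ
  · -- at most `t + 1` members of `Kt` inside `Q'`
    obtain ⟨hQ'cl, -, -⟩ := Finset.mem_filter.1 hQ'
    have hQ'card : Q'.card = t + 1 := (SimpleGraph.mem_cliqueFinset_iff.1 hQ'cl).card_eq
    calc (Kt.bipartiteBelow (fun Q Q' => Q ⊆ Q') Q').card ≤ (Q'.powersetCard t).card := by
          refine Finset.card_le_card fun Q hQ => ?_
          obtain ⟨hQK, hQQ'⟩ := (Finset.mem_bipartiteBelow _).1 hQ
          obtain ⟨hQcl, -, -⟩ := Finset.mem_filter.1 hQK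
          exact Finset.mem_powersetCard.2 ⟨hQQ', (SimpleGraph.mem_cliqueFinset_iff.1 hQcl).card_eq⟩
      _ = t + 1 := by rw [Finset.card_powersetCard, hQ'card, Nat.choose_succ_self_right]

/-- **Many cliques in a one-sidedly dense set.** If `G` has edge density `≥ δ` (`0 < δ ≤ 4`) between every two
disjoint subsets of `S` of size `≥ M ≥ 1`, then for every `T` with `4M ≤ (δ/4)^T·|S|` there are at least
`(3M)^T / T!` cliques of size `T` in `G` (inside `S`). -/
theorem pow_le_factorial_mul_card_cliqueFinset :
    ∀ {n : ℕ} (G : SimpleGraph (Fin n)) [DecidableRel G.Adj] (S : Finset (Fin n)) (M T : ℕ) (δ : ℝ),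
      0 < δ → δ ≤ 4 → 1 ≤ M →
      (∀ A ⊆ S, ∀ B ⊆ S, Disjoint A B → M ≤ A.card → M ≤ B.card → δ ≤ (G.edgeDensity A B : ℝ)) →
      (4 * M : ℝ) ≤ (δ / 4) ^ T * S.card →
      (3 * M) ^ T ≤ T.factorial * (G.cliqueFinset T).card := by
  intro n G _ S M T δ hδ hδ4 hM hdense hroom
  classical
  -- `𝒦_t`, inline
  let K : ℕ → Finset (Finset (Fin n)) := fun t => (G.cliqueFinset t).filter fun Q => Q ⊆ S ∧
      (δ / 4) ^ t * S.card ≤ ((S.filter fun v => ∀ q ∈ Q, G.Adj q v).card : ℝ)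
  have hq1 : δ / 4 ≤ 1 := by linarith
  have hq0 : 0 ≤ δ / 4 := by positivity
  -- room at every level `t ≤ T`
  have hroom' : ∀ t ≤ T, (4 * M : ℝ) ≤ (δ / 4) ^ t * S.card := by
    intro t ht
    refine hroom.trans (mul_le_mul_of_nonneg_right ?_ (by positivity))
    exact pow_le_pow_of_le_one hq0 hq1 ht
  -- induction on the level
  have key : ∀ t ≤ T, (3 * M) ^ t ≤ t.factorial * (K t).card := by
    intro t
    induction t with
    | zero =>
      intro _
      have h0 : (∅ : Finset (Fin n)) ∈ K 0 := by
        refine Finset.mem_filter.2 ⟨SimpleGraph.mem_cliqueFinset_iff.2 ?_, Finset.empty_subset _, ?_⟩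
        · exact SimpleGraph.isNClique_empty.mpr rfl
        · have : (S.filter fun v => ∀ q ∈ (∅ : Finset (Fin n)), G.Adj q v) = S :=
            Finset.filter_true_of_mem fun v _ q hq => absurd hq (Finset.notMem_empty q)
          rw [this]; simp
      have : 1 ≤ (K 0).card := Finset.card_pos.2 ⟨∅, h0⟩
      simpa using this
    | succ t ih =>
      intro ht
      have ih := ih (by omega)
      have hstep := three_mul_card_cliques_le G S hδ hM hdense t (hroom' t (by omega))
      calc (3 * M) ^ (t + 1) = 3 * M * (3 * M) ^ t := by ring
        _ ≤ 3 * M * (t.factorial * (K t).card) := Nat.mul_le_mul_left _ ih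
        _ = t.factorial * (3 * M * (K t).card) := by ring
        _ ≤ t.factorial * ((t + 1) * (K (t + 1)).card) := Nat.mul_le_mul_left _ hstep
        _ = (t + 1).factorial * (K (t + 1)).card := by rw [Nat.factorial_succ]; ring
  have hKT : (K T).card ≤ (G.cliqueFinset T).card := Finset.card_le_card (Finset.filter_subset _ _)
  exact (key T le_rfl).trans (Nat.mul_le_mul_left _ hKT)

end Counting

end Summit.PneNP.PneNP.Theorems.RamseyUncertifiableResolutionUncertainty
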